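import Mathlib
import Summits.Ventures.PercRepro2.TypedTwoTerminalSpine
import Summits.Ventures.PercRepro2.CutFarA3
import Summits.Ventures.PercRepro2.CutFarRoot

/-!
# A far `a₃` or a far root with two typed far edges is a two-terminal part (blind cell
PercRepro2, p3 g5, 2026-08-25; the kernel form of the remark in `proofs/subclaims/S2-SEPARATED.md`
§4f (3), ref-2's advisory n₂(v18))

For the one-far-mark placements of `a₃` (`RootBridge.CutFarA3`) and of the root `a₁`
(`RootBridge.CutFarRoot`) — the mark alone behind an unmarked cut vertex `c`, every edge of `F`
within a side, `z ≡ false` — the far side without `c` and the mark is an unmarked set attached to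
the rest through the two terminals «the mark» and `c`; as soon as the far side carries TWO typed
edges it is a `TwoTerminalPart` (`TwoTerminalPart.of_cutFarA3` / `of_cutFarRoot`).  Hence on every
instance without two-terminal parts (the domain of record carries `¬ HasTwoTerminalPart`) a far
`a₃` / a far root has AT MOST ONE typed far edge (`sideF_card_le_one_of_cutFarA3` /
`_of_cutFarRoot`): exactly the one-edge case — the `a₃`-pendant and root-pendant gadgets of the
exact rules `typedCount_eq_cutFarA3` / `typedCount_eq_cutFarRoot` — survives on the spine.
Own work; standard axioms.
-/

namespace Summit.Ventures.PercRepro2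

open UnionCluster

namespace CovForm

namespace TypedRed

open Separated

section FarA3

variable {V : Type*} {E : Type*} [DecidableEq E]
variable (ends : E → Sym2 V) (o a₁ a₂ a₃ b : V)

open Classical in
/-- **A far `a₃` with at least two typed far edges is a two-terminal part** with internal vertices
`VL ∖ {c, a₃}`, terminals `a₃, c` and typed edges `sideF VL F`. -/
theorem TwoTerminalPart.of_cutFarA3 {c : V} {VL VH : Set V} {F : Finset E}
    (h : RootBridge.CutFarA3 ends o a₁ a₂ a₃ b c VL VH F (fun _ => false))
    (h2 : 2 ≤ (RootBridge.sideF ends VL F).card) :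
    TwoTerminalPart ends o a₁ a₂ a₃ b F {v | v ∈ VL ∧ v ≠ c ∧ v ≠ a₃} a₃ c
      (RootBridge.sideF ends VL F) := by
  have notL : ∀ {m : V}, m ∈ VH → m ≠ c → m ∉ VL := fun {m} hmH hmc hmL => hmc (h.cap m hmL hmH)
  refine ⟨fun h' => h'.2.2 rfl, fun h' => h'.2.1 rfl, ?_, Finset.filter_subset _ _, h2, ?_, ?_⟩
  · intro v hv
    exact ⟨fun hvo => notL h.oH h.oc (hvo ▸ hv.1), fun hv1 => notL h.a1H h.a1c (hv1 ▸ hv.1),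
      fun hv2 => notL h.a2H h.a2c (hv2 ▸ hv.1), hv.2.2, fun hvb => notL h.bH h.bc (hvb ▸ hv.1)⟩
  · intro e he v hv
    obtain ⟨x, hx, y, hy, hxy⟩ := (Finset.mem_filter.1 he).2
    rw [hxy, Sym2.mem_iff] at hv
    by_cases hv3 : v = a₃
    · exact Or.inr (Or.inl hv3)
    by_cases hvc : v = c
    · exact Or.inr (Or.inr hvc)
    left
    rcases hv with rfl | rfl
    · exact ⟨hx, hvc, hv3⟩
    · exact ⟨hy, hvc, hv3⟩
  · intro e heL hvI heF
    obtain ⟨v, hvI, hve⟩ := hvI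
    have hz : zF F (fun _ => false) e = true := by simp [zF, heF]
    rcases h.split e hz with hw | hw
    · exact heL (Finset.mem_filter.2 ⟨heF, hw⟩)
    · obtain ⟨x, hx, y, hy, hxy⟩ := hw
      rw [hxy, Sym2.mem_iff] at hve
      rcases hve with rfl | rfl
      · exact hvI.2.1 (h.cap _ hvI.1 hx)
      · exact hvI.2.1 (h.cap _ hvI.1 hy)

open Classical in
/-- **A far root `a₁` with at least two typed far edges is a two-terminal part** with internal
vertices `VL ∖ {c, a₁}`, terminals `a₁, c` and typed edges `sideF VL F`. -/
theorem TwoTerminalPart.of_cutFarRoot {c : V} {VL VH : Set V} {F : Finset E}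
    (h : RootBridge.CutFarRoot ends o a₁ a₂ a₃ b c VL VH F (fun _ => false))
    (h2 : 2 ≤ (RootBridge.sideF ends VL F).card) :
    TwoTerminalPart ends o a₁ a₂ a₃ b F {v | v ∈ VL ∧ v ≠ c ∧ v ≠ a₁} a₁ c
      (RootBridge.sideF ends VL F) := by
  have notL : ∀ {m : V}, m ∈ VH → m ≠ c → m ∉ VL := fun {m} hmH hmc hmL => hmc (h.cap m hmL hmH)
  refine ⟨fun h' => h'.2.2 rfl, fun h' => h'.2.1 rfl, ?_, Finset.filter_subset _ _, h2, ?_, ?_⟩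
  · intro v hv
    exact ⟨fun hvo => notL h.oH h.oc (hvo ▸ hv.1), hv.2.2,
      fun hv2 => notL h.a2H h.a2c (hv2 ▸ hv.1), fun hv3 => notL h.a3H h.a3c (hv3 ▸ hv.1),
      fun hvb => notL h.bH h.bc (hvb ▸ hv.1)⟩
  · intro e he v hv
    obtain ⟨x, hx, y, hy, hxy⟩ := (Finset.mem_filter.1 he).2
    rw [hxy, Sym2.mem_iff] at hv
    by_cases hv1 : v = a₁
    · exact Or.inr (Or.inl hv1)
    by_cases hvc : v = c
    · exact Or.inr (Or.inr hvc)
    left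
    rcases hv with rfl | rfl
    · exact ⟨hx, hvc, hv1⟩
    · exact ⟨hy, hvc, hv1⟩
  · intro e heL hvI heF
    obtain ⟨v, hvI, hve⟩ := hvI
    have hz : zF F (fun _ => false) e = true := by simp [zF, heF]
    rcases h.split e hz with hw | hw
    · exact heL (Finset.mem_filter.2 ⟨heF, hw⟩)
    · obtain ⟨x, hx, y, hy, hxy⟩ := hw
      rw [hxy, Sym2.mem_iff] at hve
      rcases hve with rfl | rfl
      · exact hvI.2.1 (h.cap _ hvI.1 hx)
      · exact hvI.2.1 (h.cap _ hvI.1 hy)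

/-- **Without two-terminal parts a far `a₃` carries at most one typed far edge.** -/
theorem sideF_card_le_one_of_cutFarA3 {c : V} {VL VH : Set V} {F : Finset E}
    (hnt : ¬ HasTwoTerminalPart ends o a₁ a₂ a₃ b F)
    (h : RootBridge.CutFarA3 ends o a₁ a₂ a₃ b c VL VH F (fun _ => false)) :
    (RootBridge.sideF ends VL F).card ≤ 1 := by
  by_contra hcon
  exact hnt ⟨_, _, _, _, TwoTerminalPart.of_cutFarA3 ends o a₁ a₂ a₃ b h (by omega)⟩

/-- **Without two-terminal parts a far root carries at most one typed far edge.** -/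
theorem sideF_card_le_one_of_cutFarRoot {c : V} {VL VH : Set V} {F : Finset E}
    (hnt : ¬ HasTwoTerminalPart ends o a₁ a₂ a₃ b F)
    (h : RootBridge.CutFarRoot ends o a₁ a₂ a₃ b c VL VH F (fun _ => false)) :
    (RootBridge.sideF ends VL F).card ≤ 1 := by
  by_contra hcon
  exact hnt ⟨_, _, _, _, TwoTerminalPart.of_cutFarRoot ends o a₁ a₂ a₃ b h (by omega)⟩

end FarA3

end TypedRed

end CovForm

end Summit.Ventures.PercRepro2
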